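import Literature.NumberTheory.Automorphic.GL2NewvectorUpToTwist
import HarnessLib

/-!
# `ψ_χ ∘ det` is trivial on the principal congruence subgroup `K(M)` of `GL₂(𝔸_ℚ)`

Topic `NumberTheory/Automorphic`; theorems only (no definition, no named fact; D-0026). For a
Dirichlet character `χ` mod `M` and its Hecke character `ψ_χ = HeckeCharacter.ofDirichlet χ`
(`ψ_χ(x) = χ(u(x) mod M)⁻¹`), the character `ψ_χ ∘ det` of `GL₂(𝔸_ℚ)` is trivial on
`K(M) = {1} × {u ∈ GL₂(ẑ) | u ≡ 1 (M)}`: `det u ≡ 1 (mod M ẑ)`, so the ray class of `det (1, u)` mod `M`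
is trivial. This is the level hypothesis `hχ𝔪` of `AutomorphicRepData.HasSatakeParamAt.twist` /
`twist_of_isUnramifiedAt` (`AutomorphicTwistBJ`) for `ψ_χ` with the explicit level `(M)`, so that the
Satake parameters of `π ⊗ (ψ_χ ∘ det)` are available at every `p ∤ M` (Arthur–Clozel 1989, Ch. 3,
p. 172; Gelbart 1975, (3.8)).

* `valued_det_sub_one_le_of_mem_valuedCongruenceSubgroup` — `|det g - 1|_v ≤ c` for `g ≡ 1` of radius
  `c ≤ 1` in `GL₂(F)`, `F` valued;
* `Rat.rayClassHom_det_eq_one_of_mem_principalCongruenceLevel`,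
  `HeckeCharacter.ofDirichlet_det_eq_one_of_mem_principalCongruenceLevel`.

## References

* J. Neukirch, *Algebraic Number Theory* (1999), Ch. VI §1, (1.9)–(1.10); Ch. VII §6. [NeukirchANT1999]
* S. Gelbart, *Automorphic forms on adele groups* (1975), (3.2), (3.8). [Gelbart1975]
-/

noncomputable section

open scoped MatrixGroups Matrix
open NumberField IsDedekindDomain

namespace Literature.NumberTheory.Automorphic

open GaloisRepresentations Rat.HeightOneSpectrum

/-- **`|det g - 1| ≤ c` on the valued congruence subgroup of radius `c ≤ 1` in `GL₂`**:
`det g - 1 = (a-1)(d-1) + (a-1) + (d-1) - bc` with `|a-1|, |d-1|, |b|, |c| ≤ c` and `|·| ≤ 1`. [folklore] -/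
theorem valued_det_sub_one_le_of_mem_valuedCongruenceSubgroup {F : Type*} [Field F] {Γ₀ : Type*}
    [LinearOrderedCommGroupWithZero Γ₀] [Valued F Γ₀] {c : Γ₀} (hc : c ≤ 1) {g : GL (Fin 2) F}
    (hg : g ∈ valuedCongruenceSubgroup (Fin 2) c) :
    Valued.v ((g : Matrix (Fin 2) (Fin 2) F).det - 1) ≤ c := by
  obtain ⟨h1, -, h3⟩ := hg
  have ha : Valued.v ((g : Matrix (Fin 2) (Fin 2) F) 0 0 - 1) ≤ c := by
    have h := h3 0 0; rwa [Matrix.sub_apply, Matrix.one_apply_eq] at h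
  have hd : Valued.v ((g : Matrix (Fin 2) (Fin 2) F) 1 1 - 1) ≤ c := by
    have h := h3 1 1; rwa [Matrix.sub_apply, Matrix.one_apply_eq] at h
  have hb : Valued.v ((g : Matrix (Fin 2) (Fin 2) F) 0 1) ≤ c := by
    have h := h3 0 1; rwa [Matrix.sub_apply, Matrix.one_apply_ne (by decide), sub_zero] at h
  have hc' : Valued.v ((g : Matrix (Fin 2) (Fin 2) F) 1 0) ≤ 1 := h1 1 0
  have e : (g : Matrix (Fin 2) (Fin 2) F).det - 1 =
      ((g : Matrix (Fin 2) (Fin 2) F) 0 0 - 1) * ((g : Matrix (Fin 2) (Fin 2) F) 1 1 - 1) +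
        ((g : Matrix (Fin 2) (Fin 2) F) 0 0 - 1) + ((g : Matrix (Fin 2) (Fin 2) F) 1 1 - 1) -
        (g : Matrix (Fin 2) (Fin 2) F) 0 1 * (g : Matrix (Fin 2) (Fin 2) F) 1 0 := by
    rw [Matrix.det_fin_two]; ring
  rw [e]
  refine Valuation.map_sub_le _ (Valuation.map_add_le _ (Valuation.map_add_le _ ?_ ha) hd) ?_
  · rw [Valuation.map_mul]
    calc Valued.v ((g : Matrix (Fin 2) (Fin 2) F) 0 0 - 1) * Valued.v ((g : Matrix (Fin 2) (Fin 2) F) 1 1 - 1)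
        ≤ c * 1 := mul_le_mul' ha (hd.trans hc)
      _ = c := mul_one c
  · rw [Valuation.map_mul]
    calc Valued.v ((g : Matrix (Fin 2) (Fin 2) F) 0 1) * Valued.v ((g : Matrix (Fin 2) (Fin 2) F) 1 0)
        ≤ c * 1 := mul_le_mul' hb hc'
      _ = c := mul_one c

/-- **The ray class mod `M` of `det k` is trivial for `k ∈ K(M)`.** [cite: NeukirchANT1999, Ch. VI (1.9)–(1.10)] -/
theorem Rat.rayClassHom_det_eq_one_of_mem_principalCongruenceLevel {M : ℕ} [NeZero M]
    {k : GL (Fin 2) (AdeleRing (𝓞 ℚ) ℚ)} (hk : k ∈ principalCongruenceLevel 2 ℚ (Ideal.span {(M : 𝓞 ℚ)})) :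
    Rat.rayClassHom M (Matrix.GeneralLinearGroup.det k) = 1 := by
  obtain ⟨hint, hcong⟩ := mem_principalCongruenceLevel_iff.1 hk
  have hu : GLn.sndHom 2 ℚ k ∈ glFiniteIntegralLevel 2 ℚ := (mem_glIntegralLevel_iff.1 hint).1
  have hk' : GLn.ofFinite 2 ℚ (GLn.sndHom 2 ℚ k) = k := GLn.ofFinite_sndHom_of_mem hint
  rw [← hk']
  rw [Rat.rayClassHom_eq_redMod M _ (Rat.infReal_det_ofFinite_pos _) (Rat.valued_det_ofFinite_eq_one hu)]
  refine Rat.redMod_eq_one_of_valued M (Rat.valued_det_ofFinite_eq_one hu) fun q => ?_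
  set v : HeightOneSpectrum (𝓞 ℚ) := Rat.placeOfFactor M q with hv
  -- the local component of `det k` at `v` is `det k_v`
  have hloc := hcong v
  have hrad : idealRadius ℚ v (Ideal.span {(M : 𝓞 ℚ)}) = WithZero.exp (-(M.factorization q : ℤ)) := by
    rw [Rat.idealRadius_span_natCast_eq v (NeZero.ne M), hv, Rat.natGenerator_placeOfFactor]
  have hdet := valued_det_sub_one_le_of_mem_valuedCongruenceSubgroup (idealRadius_le_one' v _) hloc
  rw [hrad] at hdet
  rw [hk']
  -- `(det k)_v = det (k_v)`
  change Valued.v (((Matrix.GeneralLinearGroup.map (AdelicGroupData.adeleEval ℚ v) k : GL (Fin 2) (v.adicCompletion ℚ)) :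
    Matrix (Fin 2) (Fin 2) (v.adicCompletion ℚ)).det - 1) ≤ _ at hdet
  have hmat : ((Matrix.GeneralLinearGroup.map (AdelicGroupData.adeleEval ℚ v) k : GL (Fin 2) (v.adicCompletion ℚ)) :
      Matrix (Fin 2) (Fin 2) (v.adicCompletion ℚ)) =
      (AdelicGroupData.adeleEval ℚ v).mapMatrix (k : Matrix (Fin 2) (Fin 2) (AdeleRing (𝓞 ℚ) ℚ)) := by
    ext i j
    rw [AdelicGroupData.coe_map_adeleEval_apply, RingHom.mapMatrix_apply, Matrix.map_apply]
  have e : (((Matrix.GeneralLinearGroup.det k : ideleGroup ℚ) : AdeleRing (𝓞 ℚ) ℚ).2 v) =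
      ((Matrix.GeneralLinearGroup.map (AdelicGroupData.adeleEval ℚ v) k : GL (Fin 2) (v.adicCompletion ℚ)) :
        Matrix (Fin 2) (Fin 2) (v.adicCompletion ℚ)).det := by
    rw [hmat, ← RingHom.map_det, ← AdelicGroupData.adeleEval_apply, Matrix.GeneralLinearGroup.val_det_apply]
  rw [e]
  exact hdet

/-- **`ψ_χ(det k) = 1` for `k ∈ K(M)`**: the Hecke character of a Dirichlet character mod `M`,
composed with `det`, is trivial on the principal congruence subgroup of level `M` of `GL₂(𝔸_ℚ)` —
the level hypothesis of `AutomorphicRepData.HasSatakeParamAt.twist_of_isUnramifiedAt` with `𝔪 = (M)`.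
[cite: NeukirchANT1999, Ch. VII Prop. (6.9)] [cite: Gelbart1975, (3.8)] -/
theorem HeckeCharacter.ofDirichlet_det_eq_one_of_mem_principalCongruenceLevel {M : ℕ} [NeZero M]
    (χ : DirichletCharacter ℂ M) {k : GL (Fin 2) (AdeleRing (𝓞 ℚ) ℚ)}
    (hk : k ∈ principalCongruenceLevel 2 ℚ (Ideal.span {(M : 𝓞 ℚ)})) :
    HeckeCharacter.ofDirichlet χ (Matrix.GeneralLinearGroup.det k) = 1 := by
  rw [HeckeCharacter.ofDirichlet_apply, Rat.rayClassHom_det_eq_one_of_mem_principalCongruenceLevel hk, map_one, inv_one]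

end Literature.NumberTheory.Automorphic
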